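import Literature.AlgebraicGeometry.ShimuraVarieties.RapoportSmithlingZhang2020.Sec5GlobalIntegralModels   -- ★ `Sec3Data`/`Sec2Datum` (via §5), `hermIsSplitAt`, `IsRamifiedPlace`, `IsRamifiedOverQ`, `IsDegreeOneOverQ`; brings ★ `IntegralModel`
import Literature.AlgebraicGeometry.Resolution.ResolutionOfSingularities                                      -- ★ `Scheme.IsRegular` («regular … model», Conj. 6.1; DEDUP ED. 2)
import Mathlib.AlgebraicGeometry.Morphisms.Flat                                                                -- `AlgebraicGeometry.Flat` («flat model», Conj. 6.1)
import Mathlib.Algebra.Category.AlgCat.Basic                                                                   -- `AlgCat ℚ` (the Hecke algebra `𝓗_K` as a bundled `ℚ`-algebra, (6.4))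
import HarnessLib

/-!
# [RapoportSmithlingZhang2020Diagonal] §6 «The Arithmetic Gan–Gross–Prasad conjecture» (§6.1 «Standard conjectures on height pairing», §6.2 «Cohomology and
# Hecke–Künneth projectors», §6.3 «Arithmetic diagonal cycles», §6.4 «The Arithmetic Gan–Gross–Prasad conjecture, for a fixed level `K ⊂ H̃G(𝔸_f)`»)
# — STATED AS PRINTED (named-fact carpet; NO proofs, NO `sorry`, NO instance, NO notation)

M. Rapoport, B. Smithling, W. Zhang, *Arithmetic diagonal cycles on unitary Shimura varieties*, Compos. Math. **156** (2020)
1745–1824 = arXiv:1710.06962 **v6** (bib key `RapoportSmithlingZhang2020Diagonal`).  PAGE PINS «p. N» = arXiv v6 PDF page, read on the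
cell's per-page text of record `F0/P6/lit1/RSZ2020-v6-pages.txt` (item map `RSZ2020-v6-itemmap.lit1-g5.md` 15cc0883: «§6 pp. 30–38 (6.1 p. 31) · Conjecture
6.1 ∕ 6.2, Remarks 6.3–6.4 p. 31 · Remark 6.5, Thm. 6.6 p. 32 · Remarks 6.8–6.9 p. 34 · Conj. 6.10 p. 35 · Remark 6.11, Conj. 6.12, Remarks 6.13–6.14 p. 36 ·
Remarks 6.15–6.17 p. 37 · Remark 6.18 p. 38»; displays (6.1)–(6.3) p. 31, (6.4)–(6.5) p. 32, (6.6)–(6.11) p. 33, (6.12)–(6.15) p. 34, (6.16)–(6.19) p. 35,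
read on the pages); the Compositio offset is not held and no journal page is claimed.  Definition 6.7 (p. 32) is the only «Definition» of §6.

Cell `hodgecm-mathlib`, GO-500 carpet squad TKR (seat TKR-t04), file 3 of the t04 deal (TKR-plan SPLIT-TKR.v1 7831d55e3c6c3b32 §B∕§D: «RSZ2020 §6 →
`Sec6ArithmeticIntersectionConjecture.lean` (pp. 30–38: Conj. 6.1∕6.2, Rem. 6.3–6.5, Thm. 6.6, Rem. 6.8–6.9, Conj. 6.10, 6.12, Rem. 6.11–6.18)»; squad ruling
R-7 (TKR-plan 02:43:54Z, binding this file): a statement the source POSES but does not prove is typed as a PREDICATE ON ITS DATA, docstring «posed, not proved …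
nothing in this file claims it», locator «Conj. 6.x»; the named facts are the PROVED items (Thm. 6.6 and the remarks' proved clauses); no `@[conjecture]` obligation is
filed under `Summits/` since no route consumes these statements).  HONEST LABEL: HC_CM is proved only modulo the 7 printed citations (2 remaining: hLiu418 = stmt-HodgeConjecture-24832, h413 =
stmt-HodgeConjecture-24833) until rung 0 closes; this file asserts NOTHING — every printed claim ∕ conjecture is a `def … : Prop` that a consumer takes as a
hypothesis for ITS OWN datum, and nothing printed is claimed to hold.  The four statements 6.1, 6.2, 6.10, 6.12 that the source POSES (items «Conj. 6.x»)
are the predicates `RSZ2020_6_1_model`, `RSZ2020_6_2_surjective`, `RSZ2020_6_10`, `RSZ2020_6_12` (R-7), so that the sentences quantifying over them («Assuming 6.1 and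
6.2 …», Rem. 6.3, Conj. 6.12) can NAME them; no discharge is expected or possible here.

**ED. 2** (this edition; referee T-ref6 QA-R6-2 03:14:36Z + addendum 03:14:45Z, TKR-plan 03:15:50Z): repairs the VACUITY of four ED. 1 rows (p848543) — a
`∀ M : BBModelData …` INSIDE a body or field ranges over junk ⟨CARRIER⟩ Chow data (`ChM`, `res`, `gs`) sitting on a genuine model, so ED. 1's field `bb_spec`
forced `Ch^{n−1}(M_K(H̃G))_{ℚ,0} = 0` wherever a regular proper flat model exists, and the internal `∀ M` hypotheses of `RSZ2020_6_12`, `Rem63`, `Rem64` were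
unsatisfiable on the intended datum.  (i) The field `bb_spec` is DELETED; its content is the ROW `Sec6Data.BBSpec K M` (model `M` with its arithmetic Chow
data supplied by the consumer — the ⟨CARRIER⟩ convention of `BBModelData.Eq63_wellDefined`); (ii) the standing assumption of Conj. 6.12 («Now we assume that
Conj. 6.1 and 6.2 hold for `M_K(H̃G)`», p. 36) is the junk-safe hypothesis `∃ M, M.IsAsInConj61 ∧ M.RSZ2020_6_2_surjective ∧ BBSpec K M` (an `∃` over carriers is
witnessed by the genuine Chow data; a `∀` is not); (iii) `Rem63`, `Rem64` take the two models `(M M' : BBModelData S)` as EXPLICIT parameters.  Rule of this file: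
no `∀` over `BBModelData` ∕ `HeightSetting` inside any body or field — `∃` or explicit parameters only.  (iv) DEDUP: ED. 1's local `IsRegularScheme` is dropped for
the byte-identical ★ `Literature.AlgebraicGeometry.Resolution.Scheme.IsRegular` [StacksProject, Tag 02IS].  All other rows are byte-identical to ED. 1.
**ED. 3** (squad ruling R-9a: a tree-provable closed row is a theorem): the closed row (6.13) `Sec6Data.Eq613_range` is PROVED at the end of the file
(`Sec6Data.Eq613_range_holds`: an odd Hecke–Künneth projector kills the even degree `H^{2(n−1)}`, and `cl_{n−1}` is `𝓗_K`-equivariant by the carrier axiom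
`cl_equivariant`); every other line is byte-identical to ED. 2.

## How the printed objects are typed (paper order).  REAL = genuine Mathlib ∕ tree object; ⟨CARRIER⟩ = posited datum standing for a printed object Lean
## cannot construct (the discipline of ★ `Sec3IntegralModels.Sec3Data` and of the squad-TL carpet ★ `Liu2021.Sec3CyclesHeightPairings`); READINGS R1–R8.

* §6.1 (p. 31) is typed for ONE «smooth proper variety `X` over a number field `E`» of dimension `d` (READING R1: the category `𝒱` and the Weil cohomology
  FUNCTOR `H* : 𝒱 → grVec_K` enter only through their values on `X`): `structure HeightSetting E` with REAL `X : SchemeOver E` (★ `Motives.SchemeOver`),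
  Mathlib `SmoothOfRelativeDimension d`, `IsProper`, and ⟨CARRIER⟩ `ℚ`-spaces `Ch i` = «`Ch^i(X)_ℚ`, the group of codimension-`i` algebraic cycles in `X` modulo
  rational equivalence» (with `ℚ`-coefficients), `Hc j` = «`H^j(X)`» (READING R2: a `ℚ`-structure of the `K`-vector space `H^j(X)`, `K` of characteristic zero —
  Betti `H*(X(ℂ), ℚ)` or `ℓ`-adic; «the subspace `Ch^i(X)_{ℚ,0}` is independent of the choice of these two», p. 31, is RECORDED), and the cycle class map
  `cl i : Ch^i(X)_ℚ → H^{2i}(X)`; `Ch^i(X)_{ℚ,0} := ker cl^i` is REAL (`HeightSetting.Ch0`).  A MODEL (Conj. 6.1) is `structure BBModelData S`: the REAL ★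
  `Motives.IntegralModel (𝓞 E) E S.X` (total space `𝒳 → Spec O_E` with generic fibre `≅ X`, [SerreTate1968 §1]) with the REAL attributes «regular» (every
  stalk a regular local ring: ★ `Scheme.IsRegular`, Mathlib `IsRegularLocalRing`), «proper» (Mathlib `IsProper`), «flat» (Mathlib `Flat`), and ⟨CARRIER⟩ `ChM i` = «`Ch^i(𝒳)_ℚ`»,
  `res i` = «restriction to the generic fiber `Ch^i(𝒳)_ℚ → Ch^i(X)_ℚ`», `gs i j` = «the Arakelov pairing defined in Gillet–Soulé [16, §4.2.10],
  `( , )_{GS} : Ch^i(𝒳)_{ℚ,0} × Ch^{d+1−i}(𝒳)_{ℚ,0} → ℝ` (6.1)» (carried on all of `Ch^i(𝒳)_ℚ × Ch^j(𝒳)_ℚ`, meaningful for `j = d + 1 − i` on the `Ch_{ℚ,0}`'s —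
  READING R3: two free indices avoid the `ℕ`-subtraction `d + 1 − i` in types).  REAL on top: `Ch^i_fin(𝒳)_ℚ := ker res` («cycles supported on finite fibers»),
  `Ch^i(𝒳)_{ℚ,0} := res⁻¹(Ch^i(X)_{ℚ,0})`, the orthogonal complement `Ch^{d+1−i}_fin(𝒳)^⊥_ℚ ⊂ Ch^i(𝒳)_{ℚ,0}` (`finPerp`), Conjecture 6.2, the Beilinson–Bloch
  pairing (6.2)∕(6.3) as the REAL relation `BBRel` («lift … define `(c₁, c₂)_{BB} := (c̃₁, c̃₂)_{GS}`») with its well-definedness sentence as a named fact.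
* THE DATUM OF §§6.2–6.4 (READING R4): `structure Sec6Data extends Sec3Data, Sec2Datum` — the Shimura data of §3 (★, with `E` = ★ `reflexFieldOf Φ φ₀`) and
  `W♭`, `H = U(W♭)` of §2 (★) — carrying, for each level `K`, the ⟨CARRIER⟩ objects of §6.2–6.4.  LEVELS: «`K` for `K_{H̃G}` in `Sh_{K_{H̃G}}(H̃G)`» (p. 32), «Let
  `K ⊂ H̃G(𝔸_f)` be an open compact subgroup» (Conj. 6.10) — `K` is an open compact subgroup of the REAL topological group
  `(𝔸_{F,f})ˣ × H(𝔸_{F₀,f}) × G(𝔸_{F₀,f})` (Mathlib finite-adèle units × ★ `Wflat.Gfin` × ★ `W.Gfin`), through which `H̃G(𝔸_f) ≅ Z^ℚ(𝔸_f) × H(𝔸_{F₀,f}) × G(𝔸_{F₀,f})`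
  by (2.1) sits inside it (`Z^ℚ(𝔸_f) ⊂ (𝔸_{F,f})ˣ`); only the role of `K` as an INDEX and the attribute «open compact» are used (★ `Sec3Data` READING R3);
  `K_{H̃} ⊂ H̃(𝔸_f)` likewise in `(𝔸_{F,f})ˣ × H(𝔸_{F₀,f})`, with «`K_{H̃}` contained in `K ∩ H̃(𝔸_f)`» through the ⟨CARRIER⟩ embedding `embH : H(𝔸_{F₀,f}) → G(𝔸_{F₀,f})`
  induced by `W♭ ⊂ W` ((2.2); ★ `Gfin` is in the coordinates of ★ `W.basis`, where `diag(h, 1)` is not literal).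
* §6.2 (pp. 32–34): `M_K(H̃G)`, «the canonical model of `Sh_K(H̃G)` over `E`», smooth proper of dimension `2n − 3` («`dim M_K(H̃G) = 2n − 3` is odd», p. 34;
  properness: READING R5 — §6 treats `Sh_K(H̃G)` as a smooth proper variety, cf. footnotes 11–12 p. 32: DM-stack issues suppressed, and in the non-compact case
  `F₀ = ℚ` «one has to replace `H*(Sh_K(H̃G), ℂ)` by the image of the Betti cohomology of the toroidal compactification», RECORDED) = the ⟨CARRIER⟩ field
  `hs K : HeightSetting E` (so that §6.1 applies verbatim to `X = M_K(H̃G)`), with the axiom `hs_d`; the Hecke algebra (6.4) «`𝓗_K := C_c^∞(H̃G(𝔸_f)//K, ℚ)`,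
  bi-`K`-invariant `ℚ`-valued functions with compact support, convolution product» = ⟨CARRIER⟩ bundled `ℚ`-algebra `HK K : AlgCat ℚ` (READING R6: no instance
  is declared; `H̃G(𝔸_f)` as a locally compact group is not constructed); «Hecke correspondences associated to `f ∈ 𝓗_K`» acting on cohomology and on Chow
  groups = ⟨CARRIER⟩ algebra maps `heckeH K i : 𝓗_K → End_ℚ H^i`, `heckeCh K : 𝓗_K → End_ℚ Ch^{n−1}(M_K)_ℚ`, with the axiom `cl_equivariant` (cycle class map
  `𝓗_K`-linear).  **Theorem 6.6 (Morel–Suh)** and **Definition 6.7** are REAL statements over these carriers (`IsHeckeKunnethProjector`, `Thm66`); **Remark 6.8**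
  is typed as «`Hom_{𝓗_K}(H^+_K, H^−_K) = 0`» degree by degree (READING R7: for the semisimple modules of loc. cit. this is «share no common irreducible
  submodule»).  RECORDED, not typed: Remark 6.5 (the three hypotheses of [39] «are in fact known in our setting» — a statement about the literature),
  Matsushima's formula (6.5), the Arthur-parameter decompositions (6.6)–(6.11), `ε(π_{1,f})`, the proof of Thm. 6.6 (pp. 32–34).
* §6.3 (p. 34): `M_{K_{H̃}}(H̃) → M_K(H̃G)` «finite and unramified» (⟨CARRIER⟩ scheme `MH` + REAL morphism class Mathlib `IsFinite`; «unramified» RECORDED), «the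
  proper push-forward defines a cycle class `[M_{K_{H̃}}(H̃)] ∈ Ch^{n−1}(M_K(H̃G))_ℚ`» (⟨CARRIER⟩ element `fundClass`), «a Haar measure on `H̃(𝔸_f)` such that
  `vol(K_{H̃}) ∈ ℚ`» (⟨CARRIER⟩ `vol`), then REAL: **(6.12)** `z_K = vol(K_{H̃})·[M_{K_{H̃}}(H̃)]` (`zK`) with «independent of the choice of the group `K_{H̃}`»
  (`Eq612_independent`), `Z_K` = the cyclic Hecke submodule (`ZK`, Mathlib `Submodule.span`), **(6.13)** `R(f_−) : Ch^{n−1} → Ch^{n−1}_{ℚ,0}` (`Eq613_range`: an odd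
  Hecke–Künneth projector maps into `ker cl`), **(6.14)** `z_{K,0} = R(f_−)(z_K)` (`zK0`).  Remark 6.9 (i) consists of EXPECTATIONS («Conjecturally …», «one
  expects …», (6.15)–(6.17)) and (ii) of a comparison with [54] — RECORDED (the heckeIsotypic component (6.17) IS typed, `heckeIsotypic`, being used by Conj. 6.12).
* §6.4 (pp. 35–36): `Z_{K,0}` (`ZK0`); «`π` an automorphic representation of `H̃G(𝔸)` with trivial restriction to the central subgroup `Z^ℚ(𝔸)` … lying in a
  cohomological tempered Arthur packet» = ⟨CARRIER⟩ type `AutRep` with the ⟨CARRIER⟩ attribute `IsAsIn610`; `π_f^K` as an `𝓗_K ⊗ ℂ`-module = ⟨CARRIER⟩ `piK K π`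
  (a `ℂ`-space with a ring action of `𝓗_K`); «`L(s, π, R)`», (6.18)–(6.19) = ⟨CARRIER⟩ `ordL π : ℕ`, «the order of vanishing `ord_{s=1/2} L(s, π, R)`» (READING R8:
  only the order at `s = 1/2` enters the conjectures; the Rankin–Selberg product (6.19) is RECORDED); «the space `Hom_{H̃(𝔸_f)}(π_f, ℂ)` is one-dimensional, and
  its generator does not vanish on the subspace `π_f^K ⊂ π_f`» = ⟨CARRIER⟩ `HomHLine K π : Prop`; `Hom_{𝓗_K}(π_f^K, M)` for `M = Z_{K,0} ⊗ ℂ`, `Ch^{n−1}_{ℂ,0}` is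
  REAL (`IsHeckeEquivariant` over the complexified action `heckeChC`), «`dim = 1`» REAL as «a non-zero equivariant map exists and all are its multiples»; the
  heckeIsotypic component (6.17) REAL (`heckeIsotypic`); the Beilinson–Bloch pairing on `Ch^{n−1}(M_K(H̃G))_{ℚ,0}` («Now we assume that Conjectures 6.1 and 6.2 hold for
  `M_K(H̃G)`», p. 36) = ⟨CARRIER⟩ `bb K`, tied to §6.1 by the ROW `BBSpec K M` (for a consumer-supplied model `M` of `M_K(H̃G)` with its arithmetic Chow data, `bb K` takes values
  of the relation `BBRel` (6.3) on `Ch_{ℚ,0} × Ch_{ℚ,0}`; ED. 2), `ℓ_K : z ↦ (z, z_{K,0})_{BB}` REAL, `ℂ`-linearly extended (`ellK`; «We extend it to a hermitian form on `Ch^{n−1}(M_K(H̃G))_{ℂ,0}`», linear in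
  the first variable, Notation p. 6); **Conjecture 6.10**, **Conjecture 6.12** REAL statements over the above (`RSZ2020_6_10`, `RSZ2020_6_12`);
  «If `E = F`» = REAL `reflexFieldOf Φ φ₀ = φ₀(F)` (`EeqF`).  Remarks 6.11, 6.13, 6.14, 6.15, 6.16, 6.18 are commentary ∕ expectations ∕ comparisons with [14],
  [4, 5], [51] — RECORDED; **Remark 6.17** (p. 37, construction of cases with everywhere good reduction) is typed as its conclusion «With these definitions,
  `M_K(H̃G)` has everywhere good reduction» under its printed hypotheses on `F/F₀/ℚ`, `W`, `W♭` (REAL: ★ `hermIsSplitAt`, ★ `IsRamifiedPlace`, …), the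
  lattice recipe («we choose `Λ_v` to be self-dual when …») being RECORDED in the docstring and the level hidden in an `∃` (weaker than print, never stronger).

## References
* [RapoportSmithlingZhang2020Diagonal] M. Rapoport, B. Smithling, W. Zhang, *Arithmetic diagonal cycles on unitary Shimura varieties*, Compos. Math. 156
  (2020) 1745–1824, arXiv:1710.06962v6 — §6 pp. 30–38 ((6.1)–(6.19), Conjectures 6.1, 6.2, 6.10, 6.12, Theorem 6.6, Definition 6.7, Remarks 6.3–6.5,
  6.8–6.9, 6.11, 6.13–6.18); §2 (2.1) p. 8; §3 (3.4) p. 10, (3.15) p. 14; §1 Notation p. 6.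
* [GilletSoule1990] H. Gillet, C. Soulé, *Arithmetic intersection theory*, Publ. IHÉS 72 (1990), §4.2.10 (RSZ's [16]: the pairing (6.1)) — attribution only.
* [MorelSuh2019Sign] S. Morel, J. Suh, *The standard sign conjecture on algebraic cycles: the case of Shimura varieties*, J. reine angew. Math. (RSZ's [39],
  Th. 1.4, Lem. 2.2: Theorem 6.6) — attribution only.
* [SerreTate1968] J.-P. Serre, J. Tate, *Good reduction of abelian varieties* — §1 (the tree's ★ `IntegralModel`).
-/

noncomputable section

open scoped TensorProduct
open NumberField IsDedekindDomain CategoryTheory AlgebraicGeometry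
open Literature.AlgebraicGeometry.Motives (SchemeOver IntegralModel)
open Literature.NumberTheory.Automorphic.Liu2021.AppendixC (HermSpace)
open Literature.AlgebraicGeometry.ShimuraVarieties.RapoportSmithlingZhang2020.Sec3IntegralModels
open Literature.AlgebraicGeometry.ShimuraVarieties.RapoportSmithlingZhang2020.Sec2GroupTheoreticSetup
open Literature.AlgebraicGeometry.ShimuraVarieties.RapoportSmithlingZhang2020.Sec5GlobalIntegralModels
open Literature.AlgebraicGeometry.Resolution (Scheme.IsRegular)

namespace Literature.AlgebraicGeometry.ShimuraVarieties.RapoportSmithlingZhang2020.Sec6ArithmeticIntersectionConjecture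

/-! ## §6.1 «Standard conj[ectures] on height pairing» (p. 31): one smooth proper `X/E`, its Chow groups, a regular proper flat model (READINGS R1–R3) -/

/-- **The setting of §6.1** (p. 31) for ONE object `X` of «the category `𝒱` of smooth proper varieties over a number field `E`» (READING R1): REAL `X : SchemeOver E`,
smooth of relative dimension `d := dim X` and proper (Mathlib); ⟨CARRIER⟩ «`Ch^i(X)` the group of codimension-`i` algebraic cycles in `X` modulo rational equivalence»
with `ℚ`-coefficients (`Ch i` = `Ch^i(X)_ℚ`), the Weil cohomology «`H* : 𝒱 → grVec_K` with coefficients in a field `K` of characteristic zero» on `X` (`Hc j` = `H^j(X)`,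
READING R2: as `ℚ`-spaces), and «a cycle class map `cl^i : Ch^i(X)_ℚ → H^{2i}(X)`».  Nothing is asserted. [cite: RapoportSmithlingZhang2020Diagonal, §6.1 p. 31] -/
structure HeightSetting (E : Type) [Field E] : Type 1 where
  /-- «`X` an object in `𝒱`»: a scheme over the number field `E` (REAL). -/
  X : SchemeOver E
  /-- «`d := dim X`» ((6.1), p. 31). -/
  d : ℕ
  /-- «smooth» of dimension `d` (Mathlib `SmoothOfRelativeDimension`). -/
  smooth : SmoothOfRelativeDimension d X.hom
  /-- «proper» (Mathlib `IsProper`). -/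
  proper : IsProper X.hom
  /-- ⟨CARRIER⟩ `Ch^i(X)_ℚ` (p. 31). -/
  Ch : ℕ → ModuleCat.{0} ℚ
  /-- ⟨CARRIER⟩ `H^j(X)` (READING R2). -/
  Hc : ℕ → ModuleCat.{0} ℚ
  /-- ⟨CARRIER⟩ «a cycle class map `cl^i : Ch^i(X)_ℚ → H^{2i}(X)`» (p. 31). -/
  cl : ∀ i : ℕ, Ch i →ₗ[ℚ] Hc (2 * i)

namespace HeightSetting

variable {E : Type} [Field E] (S : HeightSetting E)

/-- «Its kernel is the group of cohomologically trivial cycles, denoted by `Ch^i(X)_{ℚ,0}`» (p. 31).  REAL (`ker cl^i`).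
[cite: RapoportSmithlingZhang2020Diagonal, §6.1 p. 31] -/
def Ch0 (i : ℕ) : Submodule ℚ (S.Ch i) :=
  LinearMap.ker (S.cl i)

/-- **[RSZ2020, Conj. 6.1]** (p. 31; attributed there to Beilinson and Bloch, «cf. [24, §2]»): «There exists a regular proper flat model `𝒳` of `X` over `Spec O_E`.»
— the statement POSED, not proved, in loc. cit. as item 6.1; typed as a predicate on the setting `S` because Remark 6.3, (6.2) and Conj. 6.12 quantify over it
(«Assuming 6.1 and 6.2 …»); nothing in this file claims it.  REAL: ★ `IntegralModel (𝓞 E) E X` whose total space is regular (★ `Scheme.IsRegular`: «regular» = every local ring `𝒪_{𝒳,x}` is a regular local ring), proper and flat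
over `Spec O_E` (Mathlib). [cite: RapoportSmithlingZhang2020Diagonal, §6.1 Conj. 6.1 p. 31] -/
def RSZ2020_6_1_model : Prop :=
  ∃ 𝒳 : IntegralModel (𝓞 E) E S.X, Scheme.IsRegular 𝒳.total.left ∧ IsProper 𝒳.total.hom ∧ Flat 𝒳.total.hom

end HeightSetting

/-- **A model as in Conj. 6.1 with its arithmetic Chow data** (p. 31: «Let `𝒳` be such a model, and consider its `i`th Chow group `Ch^i(𝒳)_ℚ`. Restriction to the
generic fiber defines a map `Ch^i(𝒳)_ℚ → Ch^i(X)_ℚ`. … We are going to use the Arakelov pairing defined in Gillet–Soulé [16, §4.2.10],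
(6.1) `( , )_{GS} : Ch^i(𝒳)_{ℚ,0} × Ch^{d+1−i}(𝒳)_{ℚ,0} → ℝ`, `d := dim X`»).  REAL: the ★ `IntegralModel`; ⟨CARRIER⟩: `ChM i` = `Ch^i(𝒳)_ℚ`, `res i` = the restriction
map, `gs i j` = the pairing (6.1) (READING R3: carried on `Ch^i(𝒳)_ℚ × Ch^j(𝒳)_ℚ`, meaningful on `Ch_{ℚ,0}` for `j = d + 1 − i`).  The attributes «regular proper flat»
are the REAL predicate `IsAsInConj61`.  Nothing is asserted. [cite: RapoportSmithlingZhang2020Diagonal, §6.1 (6.1) p. 31] -/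
structure BBModelData {E : Type} [Field E] (S : HeightSetting E) : Type 1 where
  /-- «a … model `𝒳` of `X` over `Spec O_E`» (★ `IntegralModel`: total space + generic-fibre isomorphism). -/
  model : IntegralModel (𝓞 E) E S.X
  /-- ⟨CARRIER⟩ «its `i`th Chow group `Ch^i(𝒳)_ℚ`». -/
  ChM : ℕ → ModuleCat.{0} ℚ
  /-- ⟨CARRIER⟩ «Restriction to the generic fiber defines a map `Ch^i(𝒳)_ℚ → Ch^i(X)_ℚ`». -/
  res : ∀ i : ℕ, ChM i →ₗ[ℚ] S.Ch i
  /-- ⟨CARRIER⟩ **(6.1)** «the Arakelov pairing … `( , )_{GS} : Ch^i(𝒳)_{ℚ,0} × Ch^{d+1−i}(𝒳)_{ℚ,0} → ℝ`» (READING R3). -/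
  gs : ∀ i j : ℕ, ChM i →ₗ[ℚ] ChM j →ₗ[ℚ] ℝ

namespace BBModelData

variable {E : Type} [Field E] {S : HeightSetting E} (M : BBModelData S)

/-- «regular proper flat model» (Conj. 6.1, Rem. 6.3): the REAL attributes of the model's structure morphism `𝒳 → Spec O_E`.
[cite: RapoportSmithlingZhang2020Diagonal, §6.1 Conj. 6.1 p. 31] -/
def IsAsInConj61 : Prop :=
  Scheme.IsRegular M.model.total.left ∧ IsProper M.model.total.hom ∧ Flat M.model.total.hom

/-- «Let `Ch^i_fin(𝒳)_ℚ` be the kernel of this map (cycles supported on “finite fibers”)» (p. 31).  REAL. [cite: RapoportSmithlingZhang2020Diagonal, §6.1 p. 31] -/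
def ChFin (i : ℕ) : Submodule ℚ (M.ChM i) :=
  LinearMap.ker (M.res i)

/-- «and let `Ch^i(𝒳)_{ℚ,0}` be the pre-image of `Ch^i(X)_{ℚ,0}`» (p. 31).  REAL. [cite: RapoportSmithlingZhang2020Diagonal, §6.1 p. 31] -/
def Ch0 (i : ℕ) : Submodule ℚ (M.ChM i) :=
  Submodule.comap (M.res i) (S.Ch0 i)

/-- «Let `Ch^{d+1−i}_fin(𝒳)^⊥_ℚ ⊂ Ch^i(𝒳)_{ℚ,0}` be the orthogonal complement of `Ch^{d+1−i}_fin(𝒳)_ℚ` under the pairing (6.1)» (p. 31), as the set of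
`x ∈ Ch^i(𝒳)_{ℚ,0}` with `(x, y)_{GS} = 0` for all `y ∈ Ch^j_fin(𝒳)_ℚ` (READING R3: `j = d + 1 − i`).  REAL. [cite: RapoportSmithlingZhang2020Diagonal, §6.1 p. 31] -/
def finPerp (i j : ℕ) : Set (M.ChM i) :=
  {x | x ∈ M.Ch0 i ∧ ∀ y ∈ M.ChFin j, M.gs i j x y = 0}

/-- **[RSZ2020, Conj. 6.2]** (p. 31; Beilinson–Bloch, «cf. [24, §2]»): «The natural map `Ch^{d+1−i}_fin(𝒳)^⊥_ℚ → Ch^i(X)_{ℚ,0}` is surjective.» (the natural map =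
restriction to the generic fibre), for every `i` — the statement POSED, not proved, in loc. cit. as item 6.2; typed as a predicate on the model `𝒳` because
(6.2)∕(6.3), Remarks 6.3–6.4 and Conj. 6.12 quantify over it; nothing in this file claims it. [cite: RapoportSmithlingZhang2020Diagonal, §6.1 Conj. 6.2 p. 31] -/
def RSZ2020_6_2_surjective : Prop :=
  ∀ i : ℕ, ∀ c ∈ S.Ch0 i, ∃ x ∈ M.finPerp i (S.d + 1 - i), M.res i x = c

/-- **The Beilinson–Bloch height pairing (6.2)∕(6.3)** (p. 31): «Assuming Conj. 6.1 and 6.2 above, the height pairing of Beilinson and Bloch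
`( , )_{BB} : Ch^i(X)_{ℚ,0} × Ch^{d+1−i}(X)_{ℚ,0} → ℝ` (6.2) can be defined as follows. Lift the elements `c₁ ∈ Ch^i(X)_{ℚ,0}` and `c₂ ∈ Ch^{d+1−i}(X)_{ℚ,0}` to
`c̃₁ ∈ Ch^{d+1−i}_fin(𝒳)^⊥_ℚ` and `c̃₂ ∈ Ch^i_fin(𝒳)^⊥_ℚ`, respectively. Define `(c₁, c₂)_{BB} := (c̃₁, c̃₂)_{GS}` (6.3).» — as the REAL relation «`r` is a value
`(c̃₁, c̃₂)_{GS}` for some pair of such lifts» (READING R3: degrees `i`, `j = d + 1 − i`). [cite: RapoportSmithlingZhang2020Diagonal, §6.1 (6.2)–(6.3) p. 31] -/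
def BBRel (i j : ℕ) (c₁ : S.Ch i) (c₂ : S.Ch j) (r : ℝ) : Prop :=
  ∃ x ∈ M.finPerp i j, ∃ y ∈ M.finPerp j i, M.res i x = c₁ ∧ M.res j y = c₂ ∧ r = M.gs i j x y

/-- **(6.3) is well defined** (p. 31): «It is easy to see that this is independent of the choices of the liftings» — for a regular proper flat model satisfying
Conj. 6.2, the relation `BBRel` is single-valued on `Ch^i(X)_{ℚ,0} × Ch^{d+1−i}(X)_{ℚ,0}`.  Named fact (predicate on the model).
[cite: RapoportSmithlingZhang2020Diagonal, §6.1 (6.3) p. 31] -/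
def Eq63_wellDefined : Prop :=
  M.IsAsInConj61 → M.RSZ2020_6_2_surjective →
    ∀ i : ℕ, ∀ c₁ ∈ S.Ch0 i, ∀ c₂ ∈ S.Ch0 (S.d + 1 - i), ∀ r r' : ℝ,
      M.BBRel i (S.d + 1 - i) c₁ c₂ r → M.BBRel i (S.d + 1 - i) c₁ c₂ r' → r = r'

end BBModelData

/-- **[RSZ2020, Remark 6.3]** (p. 31): «Assuming Conj. 6.1 and 6.2, the pairing (6.2) is independent of the choice of the (regular proper flat) integral model
`𝒳`, cf. [35, Lem. 1.5].»  Named fact — predicate on TWO models `𝒳`, `𝒳'` of the same `X` with their arithmetic Chow data, supplied by the consumer as explicit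
parameters (ED. 2: no internal `∀` over ⟨CARRIER⟩ Chow data). [cite: RapoportSmithlingZhang2020Diagonal, §6.1 Remark 6.3 p. 31] -/
def Rem63 {E : Type} [Field E] {S : HeightSetting E} (M M' : BBModelData S) : Prop :=
  M.IsAsInConj61 → M'.IsAsInConj61 → M.RSZ2020_6_2_surjective → M'.RSZ2020_6_2_surjective →
    ∀ i : ℕ, ∀ c₁ ∈ S.Ch0 i, ∀ c₂ ∈ S.Ch0 (S.d + 1 - i), ∀ r : ℝ,
      M.BBRel i (S.d + 1 - i) c₁ c₂ r ↔ M'.BBRel i (S.d + 1 - i) c₁ c₂ r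

/-- **[RSZ2020, Remark 6.4]** (p. 31): «Assume that there exists a smooth proper model `𝒳` of `X` over `O_E`. Then by [34, Th. 6.11], Conj. 6.2 holds for `𝒳`
and therefore the intersection product (6.2) is defined; again, by [35, Lem. 1.5], the intersection product is independent of the choice of `𝒳` (assumed to be
smooth and proper).» — typed: a model that is smooth of relative dimension `d` and proper (★ `IntegralModel.IsSmoothProper`) satisfies Conj. 6.2, and any
two such models give the same pairing.  Named fact — predicate on TWO models `𝒳`, `𝒳'` with their arithmetic Chow data, supplied by the consumer as explicit
parameters (first clause on `𝒳` alone; ED. 2: no internal `∀` over ⟨CARRIER⟩ Chow data). [cite: RapoportSmithlingZhang2020Diagonal, §6.1 Remark 6.4 p. 31] -/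
def Rem64 {E : Type} [Field E] {S : HeightSetting E} (M M' : BBModelData S) : Prop :=
  (M.model.IsSmoothProper S.d → M.RSZ2020_6_2_surjective) ∧
  (M.model.IsSmoothProper S.d → M'.model.IsSmoothProper S.d →
    ∀ i : ℕ, ∀ c₁ ∈ S.Ch0 i, ∀ c₂ ∈ S.Ch0 (S.d + 1 - i), ∀ r : ℝ,
      M.BBRel i (S.d + 1 - i) c₁ c₂ r ↔ M'.BBRel i (S.d + 1 - i) c₁ c₂ r)

/-! ## §§6.2–6.4: the datum (READINGS R4–R8) -/

variable (F₀ F : Type) [Field F₀] [NumberField F₀] [IsTotallyReal F₀] [Field F] [NumberField F] [Algebra F₀ F]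
  [IsTotallyComplex F] [Algebra.IsQuadraticExtension F₀ F]

/-- **The datum of [RSZ2020] §§6.2–6.4** (pp. 32–37): the Shimura data of §3 (★ `Sec3Data`, `E` = ★ `reflexFieldOf Φ φ₀`) and `W♭ ⊂ W` of §2 (★ `Sec2Datum`), with,
for every level `K` (an open compact subgroup of the REAL group `(𝔸_{F,f})ˣ × H(𝔸_{F₀,f}) × G(𝔸_{F₀,f})`, READING R4), the ⟨CARRIER⟩ objects: `hs K` = the smooth
proper `E`-variety `M_K(H̃G)` of dimension `2n − 3` with its Chow groups, cohomology and cycle class maps (a ★ `HeightSetting`, §6.1); the Hecke algebra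
`𝓗_K` (6.4) as a bundled `ℚ`-algebra and its actions by Hecke correspondences on `H^i(Sh_K(H̃G), ℚ)` and on `Ch^{n−1}(M_K(H̃G))_ℚ` (p. 32, p. 34); the ⟨CARRIER⟩
embedding `H(𝔸_{F₀,f}) → G(𝔸_{F₀,f})` of (2.2); for every level `K_{H̃}` of `H̃`, the `E`-variety `M_{K_{H̃}}(H̃)`, the finite morphism `M_{K_{H̃}}(H̃) → M_K(H̃G)` and its
push-forward class (p. 34); the rational volumes `vol(K_{H̃})` (p. 34); the automorphic representations `π` of §6.4 with `π_f^K`, `ord_{s=1/2} L(s, π, R)` and the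
`Hom_{H̃(𝔸_f)}`-line condition (pp. 35–36); the Beilinson–Bloch pairing on `Ch^{n−1}(M_K(H̃G))_{ℚ,0}` (p. 36).  `Prop` fields are AXIOMS of the posited objects
(`hs_d`; cycle class map `𝓗_K`-equivariant), not printed results; the tie of `bb` to the pairing (6.2)∕(6.3) of §6.1 is the ROW `Sec6Data.BBSpec` (ED. 2).  Nothing is asserted; a consumer supplies the datum.
[cite: RapoportSmithlingZhang2020Diagonal, §6.2 p. 32, §6.3 p. 34, §6.4 pp. 35–36] -/
structure Sec6Data : Type 2 extends Sec3Data F₀ F, Sec2Datum F₀ F where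
  /-- ⟨CARRIER⟩ the embedding `H(𝔸_{F₀,f}) ↪ G(𝔸_{F₀,f})` induced by `W = W♭ ⊕ F u` ((2.2) `h ↦ diag(h, 1)` in adapted coordinates; here between ★ `Wflat.Gfin` and ★
  `W.Gfin`, which are in the coordinates of ★ `HermSpace.basis`), used for «`K_{H̃}` … contained in `K ∩ H̃(𝔸_f)`» (p. 34). -/
  embH : Wflat.Gfin →* W.Gfin
  /-- ⟨CARRIER⟩ **`M_K(H̃G)`**, «the canonical model of `Sh_K(H̃G)` over `E`» (p. 34), as a §6.1 setting: the `E`-variety with its Chow groups `Ch^i(M_K(H̃G))_ℚ`, its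
  (Betti) cohomology «`H^i(Sh_K(H̃G), ℚ)`» (p. 32) and cycle class maps «`cl_{n−1} : Ch^{n−1}(M_K(H̃G))_ℚ → H^{2(n−1)}(Sh_K(H̃G), ℚ)`» (p. 34); indexed by the level
  `K` (READING R4; meaningful for `K` open compact). -/
  hs : Subgroup ((FiniteAdeleRing (𝓞 F) F)ˣ × Wflat.Gfin × W.Gfin) → HeightSetting (reflexFieldOf Φ φ₀)
  /-- AXIOM of the carrier: «Note that `dim M_K(H̃G) = 2n − 3` is odd» (p. 34). -/
  hs_d : ∀ K, (hs K).d = 2 * W.n - 3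
  /-- ⟨CARRIER⟩ **(6.4)** «`𝓗_K := C_c^∞(H̃G(𝔸_f)//K, ℚ)`, the Hecke algebra of bi-`K`-invariant `ℚ`-valued functions with compact support, with multiplication given by
  the convolution product» (p. 32), as a bundled `ℚ`-algebra (READING R6). -/
  HK : Subgroup ((FiniteAdeleRing (𝓞 F) F)ˣ × Wflat.Gfin × W.Gfin) → AlgCat.{0} ℚ
  /-- ⟨CARRIER⟩ «the Hecke correspondences associated to `f ∈ 𝓗_K`» acting on `H^i(Sh_K(H̃G), ℚ)` (p. 32). -/
  heckeH : ∀ K (i : ℕ), HK K →ₐ[ℚ] Module.End ℚ ((hs K).Hc i)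
  /-- ⟨CARRIER⟩ the Hecke correspondences acting on `Ch^{n−1}(M_K(H̃G))_ℚ` («the cyclic Hecke submodule of `Ch^{n−1}(M_K(H̃G))_ℚ`», p. 34). -/
  heckeCh : ∀ K, HK K →ₐ[ℚ] Module.End ℚ ((hs K).Ch (W.n - 1))
  /-- AXIOM of the carriers: the cycle class map `cl_{n−1}` commutes with the Hecke correspondences (algebraic correspondences act compatibly on Chow groups and
  cohomology; used in (6.13)). -/
  cl_equivariant : ∀ K (f : HK K) (x : (hs K).Ch (W.n - 1)),
    (hs K).cl (W.n - 1) (heckeCh K f x) = heckeH K (2 * (W.n - 1)) f ((hs K).cl (W.n - 1) x)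
  /-- ⟨CARRIER⟩ **`M_{K_{H̃}}(H̃)`** over `E` for a level `K_{H̃} ⊂ H̃(𝔸_f)` (p. 34; READING R4: `K_{H̃}` an open compact subgroup of `(𝔸_{F,f})ˣ × H(𝔸_{F₀,f})`). -/
  MH : Subgroup ((FiniteAdeleRing (𝓞 F) F)ˣ × Wflat.Gfin) → SchemeOver (reflexFieldOf Φ φ₀)
  /-- ⟨CARRIER⟩ «a finite and unramified morphism `M_{K_{H̃}}(H̃) → M_K(H̃G)`» (p. 34) for `K_{H̃} ⊂ K ∩ H̃(𝔸_f)` (a morphism of `E`-schemes; finiteness is the REAL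
  predicate `IsFinite` in `Eq612_independent`; «unramified» RECORDED). -/
  toMK : ∀ (KH : Subgroup ((FiniteAdeleRing (𝓞 F) F)ˣ × Wflat.Gfin)) (K : Subgroup ((FiniteAdeleRing (𝓞 F) F)ˣ × Wflat.Gfin × W.Gfin)),
    (MH KH ⟶ (hs K).X)
  /-- ⟨CARRIER⟩ «The proper push-forward defines a cycle class `[M_{K_{H̃}}(H̃)] ∈ Ch^{n−1}(M_K(H̃G))_ℚ`» (p. 34). -/
  fundClass : ∀ (KH : Subgroup ((FiniteAdeleRing (𝓞 F) F)ˣ × Wflat.Gfin)) (K : Subgroup ((FiniteAdeleRing (𝓞 F) F)ˣ × Wflat.Gfin × W.Gfin)),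
    (hs K).Ch (W.n - 1)
  /-- ⟨CARRIER⟩ «We now fix a Haar measure on `H̃(𝔸_f)` such that the volume `vol(K_{H̃}) ∈ ℚ`» (p. 34): the volumes of the levels of `H̃`. -/
  vol : Subgroup ((FiniteAdeleRing (𝓞 F) F)ˣ × Wflat.Gfin) → ℚ
  /-- ⟨CARRIER⟩ the automorphic representations «`π` … of `H̃G(𝔸)`» of §6.4 (p. 35), a type of names. -/
  AutRep : Type
  /-- ⟨CARRIER⟩ «`π` … with trivial restriction to the central subgroup `Z^ℚ(𝔸)` and lying in a cohomological tempered Arthur packet» (Conj. 6.10 p. 35; «cohomological»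
  refers to `π_∞` and the trivial coefficient system, p. 35). -/
  IsAsIn610 : AutRep → Prop
  /-- ⟨CARRIER⟩ `π_f^K`, the `K`-invariants of the finite part, as a `ℂ`-vector space (pp. 33, 35). -/
  piK : Subgroup ((FiniteAdeleRing (𝓞 F) F)ˣ × Wflat.Gfin × W.Gfin) → AutRep → ModuleCat.{0} ℂ
  /-- ⟨CARRIER⟩ the action of `𝓗_K` on `π_f^K` (p. 33: «`𝓗_K` acts … through the space `π_f^K`»), as a ring action by `ℂ`-linear maps. -/
  heckePi : ∀ K π, HK K →+* Module.End ℂ (piK K π)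
  /-- ⟨CARRIER⟩ «the order of vanishing `ord_{s=1/2} L(s, π, R)`» of «the `L`-function `L(s, π, R)`» (6.19) (pp. 35–36; READING R8). -/
  ordL : AutRep → ℕ
  /-- ⟨CARRIER⟩ «the space `Hom_{H̃(𝔸_f)}(π_f, ℂ)` is one-dimensional, and its generator does not vanish on the subspace `π_f^K ⊂ π_f`» (Conj. 6.10 (b), Conj. 6.12 (b),
  pp. 35–36). -/
  HomHLine : Subgroup ((FiniteAdeleRing (𝓞 F) F)ˣ × Wflat.Gfin × W.Gfin) → AutRep → Prop
  /-- ⟨CARRIER⟩ «the Beilinson–Bloch height pairing (6.2) between cohomologically trivial cycles for `i = n − 1`» on `M_K(H̃G)` («Now we assume that Conj. 6.1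
  and 6.2 hold for `M_K(H̃G)`», p. 36), carried on all of `Ch^{n−1}(M_K(H̃G))_ℚ` (junk off `Ch_{ℚ,0}`; its tie to (6.2)∕(6.3) of §6.1 is the ROW `Sec6Data.BBSpec`, ED. 2). -/
  bb : ∀ K, (hs K).Ch (W.n - 1) →ₗ[ℚ] (hs K).Ch (W.n - 1) →ₗ[ℚ] ℝ

namespace Sec6Data

variable {F₀ F}
variable (D : Sec6Data F₀ F)

/-- The REAL ambient of the levels (READING R4): `(𝔸_{F,f})ˣ × H(𝔸_{F₀,f}) × G(𝔸_{F₀,f})` ⊇ `Z^ℚ(𝔸_f) × H(𝔸_{F₀,f}) × G(𝔸_{F₀,f}) ≅ H̃G(𝔸_f)` ((2.1) p. 8), a topological group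
(Mathlib finite adèles; ★ `HermSpace.Gfin`). [cite: RapoportSmithlingZhang2020Diagonal, §2.1 (2.1) p. 8] -/
abbrev LevelAmb : Type := (FiniteAdeleRing (𝓞 F) F)ˣ × D.Wflat.Gfin × D.W.Gfin

/-- «Let `K ⊂ H̃G(𝔸_f)` be an open compact subgroup» (Conj. 6.10 p. 35; §3.1). REAL attribute of a level (READING R4).
[cite: RapoportSmithlingZhang2020Diagonal, §6.4 Conj. 6.10 p. 35] -/
def IsLevelHG (K : Subgroup D.LevelAmb) : Prop :=
  IsOpen (K : Set D.LevelAmb) ∧ IsCompact (K : Set D.LevelAmb)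

/-- «If `E = F`» (Conj. 6.10, Rem. 6.11, 6.13, 6.15): the reflex field `E = E_Φ · φ₀(F) ⊂ ℂ` (★ `reflexFieldOf`) equals `φ₀(F)` («`φ₀` always embeds `F` into `E`, but
`E` may be larger», Remark 3.1 p. 9).  REAL. [cite: RapoportSmithlingZhang2020Diagonal, §6.4 Conj. 6.10 p. 36] -/
def EeqF : Prop :=
  reflexFieldOf D.Φ D.φ₀ = D.φ₀.toRatAlgHom.fieldRange

/-! ## §6.2 (pp. 32–34): Hecke–Künneth projectors — Theorem 6.6 (Morel–Suh), Definition 6.7, Remark 6.8 -/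

/-- **[RSZ2020, Definition 6.7 ∕ the property in Theorem 6.6]** (p. 32): `f ∈ 𝓗_K` «induces the projector to the even, resp. odd, degree cohomology
`⊕_{i ∈ ℤ} H^i(Sh_K(H̃G), ℚ) → ⊕_{i ≡ ε mod 2} H^i(Sh_K(H̃G), ℚ)`» for `ε ∈ ℤ/2ℤ` — i.e. the Hecke correspondence of `f` acts as the identity on `H^i` for `i ≡ ε`
and as `0` for `i ≢ ε`; «We set `f_+ = f_0` and `f_− = f_1` as in Theorem 6.6, and call them the even, resp. odd, Hecke–Künneth projectors in `𝓗_K`» (Def. 6.7).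
REAL over the carriers. [cite: RapoportSmithlingZhang2020Diagonal, §6.2 Definition 6.7 p. 32] -/
def IsHeckeKunnethProjector (K : Subgroup D.LevelAmb) (ε : ZMod 2) (f : D.HK K) : Prop :=
  ∀ i : ℕ, D.heckeH K i f = if (i : ZMod 2) = ε then 1 else 0

/-- **[RSZ2020, Theorem 6.6 (Morel–Suh)]** (p. 32): «Let `ε ∈ ℤ/2ℤ`. Then there exists `f_ε` in `𝓗_K` such that the associated Hecke correspondence induces the
projector to the even, resp. odd, degree cohomology, `⊕_{i ∈ ℤ} H^i(Sh_K(H̃G), ℚ) → ⊕_{i ≡ ε mod 2} H^i(Sh_K(H̃G), ℚ)`.» («This follows from [39, Th. 1.4, Lem. 2.2]»;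
the hypotheses of [39] «are in fact known in our setting», Remark 6.5, RECORDED.)  For every open compact `K`.  Named fact (predicate on the datum).
[cite: RapoportSmithlingZhang2020Diagonal, §6.2 Thm. 6.6 p. 32] -/
def Thm66 : Prop :=
  ∀ K : Subgroup D.LevelAmb, D.IsLevelHG K → ∀ ε : ZMod 2, ∃ f : D.HK K, D.IsHeckeKunnethProjector K ε f

/-- **[RSZ2020, Remark 6.8]** (p. 34): «Let `H^ε_K := ⊕_{i ≡ ε mod 2} H^i(Sh_K(H̃G), ℚ)`. Then [39, Th. 1.4] asserts that `H^+_K` and `H^−_K`, both being semisimple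
`𝓗_K`-modules, do not share any common irreducible `𝓗_K`-submodule.» — READING R7: for semisimple modules this is `Hom_{𝓗_K}(H^i, H^j) = 0` whenever `i` is even
and `j` odd, typed degree by degree.  Named fact (predicate on the datum). [cite: RapoportSmithlingZhang2020Diagonal, §6.2 Remark 6.8 p. 34] -/
def Rem68 : Prop :=
  ∀ K : Subgroup D.LevelAmb, D.IsLevelHG K → ∀ i j : ℕ, Even i → Odd j →
    ∀ φ : (D.hs K).Hc i →ₗ[ℚ] (D.hs K).Hc j,
      (∀ f : D.HK K, φ ∘ₗ D.heckeH K i f = D.heckeH K j f ∘ₗ φ) → φ = 0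

/-! ## §6.3 «Arithmetic diagonal cycles» (p. 34): (6.12) `z_K`, `Z_K`, (6.13) `R(f_−)`, (6.14) `z_{K,0}` -/

/-- **The auxiliary level `K_{H̃}`** of §6.3 (p. 34): «Let `K_{H̃}` be a compact open subgroup of `H̃(𝔸_f)` contained in `K ∩ H̃(𝔸_f)`. We have a finite and
unramified morphism `M_{K_{H̃}}(H̃) → M_K(H̃G)`» — `K_{H̃}` open compact in the REAL ambient `(𝔸_{F,f})ˣ × H(𝔸_{F₀,f})` (READING R4), contained in `K` through the
⟨CARRIER⟩ embedding `embH`, and the ⟨CARRIER⟩ morphism `toMK` finite (Mathlib `IsFinite`; «unramified» RECORDED).  REAL attribute bundle.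
[cite: RapoportSmithlingZhang2020Diagonal, §6.3 p. 34] -/
def IsDiagonalLevel (K : Subgroup D.LevelAmb) (KH : Subgroup ((FiniteAdeleRing (𝓞 F) F)ˣ × D.Wflat.Gfin)) : Prop :=
  IsOpen (KH : Set ((FiniteAdeleRing (𝓞 F) F)ˣ × D.Wflat.Gfin)) ∧ IsCompact (KH : Set ((FiniteAdeleRing (𝓞 F) F)ˣ × D.Wflat.Gfin)) ∧
    (∀ p ∈ KH, ((p.1, p.2, D.embH p.2) : D.LevelAmb) ∈ K) ∧ IsFinite (D.toMK KH K).left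

/-- **(6.12)** «the normalized class `z_K = vol(K_{H̃})·[M_{K_{H̃}}(H̃)] ∈ Ch^{n−1}(M_K(H̃G))_ℚ`» (p. 34), for a level `K_{H̃}` of `H̃` (⟨CARRIER⟩ `vol`, `fundClass`; REAL scalar
multiple).  «We call `z_K` the arithmetic diagonal cycle since it lies in the arithmetic middle dimension, i.e., `2 dim z_K = dim M_K(H̃G) + 1`.»
[cite: RapoportSmithlingZhang2020Diagonal, §6.3 (6.12) p. 34] -/
def zK (KH : Subgroup ((FiniteAdeleRing (𝓞 F) F)ˣ × D.Wflat.Gfin)) (K : Subgroup D.LevelAmb) : (D.hs K).Ch (D.W.n - 1) :=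
  D.vol KH • D.fundClass KH K

/-- **(6.12) is independent of `K_{H̃}`** (p. 34): for «a compact open subgroup `K_{H̃}` of `H̃(𝔸_f)` contained in `K ∩ H̃(𝔸_f)`», with «a finite and unramified
morphism `M_{K_{H̃}}(H̃) → M_K(H̃G)`», «`z_K` … is independent of the choice of the group `K_{H̃}`» — for any two auxiliary levels as in `IsDiagonalLevel`.  Named fact
(predicate on the datum). [cite: RapoportSmithlingZhang2020Diagonal, §6.3 (6.12) p. 34] -/
def Eq612_independent : Prop :=
  ∀ K : Subgroup D.LevelAmb, D.IsLevelHG K →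
    ∀ KH KH' : Subgroup ((FiniteAdeleRing (𝓞 F) F)ˣ × D.Wflat.Gfin), D.IsDiagonalLevel K KH → D.IsDiagonalLevel K KH' →
      D.zK KH K = D.zK KH' K

/-- «Let `Z_K` be the cyclic Hecke submodule of `Ch^{n−1}(M_K(H̃G))_ℚ` generated by `z_K`» (p. 34): the `ℚ`-span of the orbit `{f·z_K ∣ f ∈ 𝓗_K}`.  REAL (Mathlib
`Submodule.span`). [cite: RapoportSmithlingZhang2020Diagonal, §6.3 p. 34] -/
def ZK (KH : Subgroup ((FiniteAdeleRing (𝓞 F) F)ˣ × D.Wflat.Gfin)) (K : Subgroup D.LevelAmb) : Submodule ℚ ((D.hs K).Ch (D.W.n - 1)) :=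
  Submodule.span ℚ (Set.range fun f : D.HK K => D.heckeCh K f (D.zK KH K))

/-- **(6.13)** (p. 34): «Let `f_− ∈ 𝓗_K` be an odd Hecke–Künneth projector, cf. Definition 6.7. We obtain a map to the Chow group of cohomologically trivial cycles,
`R(f_−) : Ch^{n−1}(M_K(H̃G))_ℚ → Ch^{n−1}(M_K(H̃G))_{ℚ,0}`» — the Hecke operator of an odd projector takes values in `ker cl_{n−1}` (it kills `H^{2(n−1)}`, an even
degree; the axiom `cl_equivariant`).  Named fact (predicate on the datum). [cite: RapoportSmithlingZhang2020Diagonal, §6.3 (6.13) p. 34] -/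
def Eq613_range : Prop :=
  ∀ K : Subgroup D.LevelAmb, ∀ f : D.HK K, D.IsHeckeKunnethProjector K 1 f →
    ∀ x : (D.hs K).Ch (D.W.n - 1), D.heckeCh K f x ∈ (D.hs K).Ch0 (D.W.n - 1)

/-- **(6.14)** «a cohomologically trivial cycle in the Chow group, `z_{K,0} = R(f_−)(z_K) ∈ Ch^{n−1}(M_K(H̃G))_{ℚ,0}` … the cohomologically trivial arithmetic diagonal
cycle» (p. 34), for a chosen odd Hecke–Künneth projector `f = f_−` (Remark 6.9 (i) discusses the dependence on this choice — RECORDED).  REAL.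
[cite: RapoportSmithlingZhang2020Diagonal, §6.3 (6.14) p. 34] -/
def zK0 (KH : Subgroup ((FiniteAdeleRing (𝓞 F) F)ˣ × D.Wflat.Gfin)) (K : Subgroup D.LevelAmb) (f : D.HK K) : (D.hs K).Ch (D.W.n - 1) :=
  D.heckeCh K f (D.zK KH K)

/-! ## §6.4 (pp. 35–36): `Z_{K,0}`, complexification, `Hom_{𝓗_K}`, heckeIsotypic components (6.17), `ℓ_K`, Conj. 6.10 and 6.12 -/

/-- «Let `Z_{K,0}` denote the cyclic Hecke submodule of `Ch^{n−1}(M_K(H̃G))_{ℚ,0}` generated by `z_{K,0}` or, equivalently, the image of `Z_K` under the map `R(f_−)`»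
(p. 35).  REAL. [cite: RapoportSmithlingZhang2020Diagonal, §6.4 p. 35] -/
def ZK0 (KH : Subgroup ((FiniteAdeleRing (𝓞 F) F)ˣ × D.Wflat.Gfin)) (K : Subgroup D.LevelAmb) (f : D.HK K) :
    Submodule ℚ ((D.hs K).Ch (D.W.n - 1)) :=
  Submodule.span ℚ (Set.range fun g : D.HK K => D.heckeCh K g (D.zK0 KH K f))

/-- The action of `𝓗_K` on the complexification `Ch^{n−1}(M_K(H̃G))_ℂ = ℂ ⊗_ℚ Ch^{n−1}(M_K(H̃G))_ℚ` («`𝓗_{K,ℂ} = 𝓗_K ⊗ ℂ`», p. 32; (6.16)–(6.17) p. 35): base change of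
the ⟨CARRIER⟩ action `heckeCh`.  REAL (Mathlib `LinearMap.baseChange`). [cite: RapoportSmithlingZhang2020Diagonal, §6.4 (6.16) p. 35] -/
def heckeChC (K : Subgroup D.LevelAmb) (f : D.HK K) : ℂ ⊗[ℚ] (D.hs K).Ch (D.W.n - 1) →ₗ[ℂ] ℂ ⊗[ℚ] (D.hs K).Ch (D.W.n - 1) :=
  (D.heckeCh K f).baseChange ℂ

/-- **`Hom_{𝓗_K}(π_f^K, M)`** membership (pp. 35–36) for `M = Ch^{n−1}(M_K(H̃G))_ℂ` with the action `heckeChC`: a `ℂ`-linear map `φ : π_f^K → M` commuting with `𝓗_K`.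
REAL over the carriers. [cite: RapoportSmithlingZhang2020Diagonal, §6.4 Conj. 6.10 p. 35] -/
def IsHeckeEquivariant (K : Subgroup D.LevelAmb) (π : D.AutRep) (φ : D.piK K π →ₗ[ℂ] ℂ ⊗[ℚ] (D.hs K).Ch (D.W.n - 1)) : Prop :=
  ∀ f : D.HK K, φ ∘ₗ (D.heckePi K π f : D.piK K π →ₗ[ℂ] D.piK K π) = D.heckeChC K f ∘ₗ φ

/-- **The `π_f^K`-heckeIsotypic component `M[π_f^K]` of an `𝓗_K`-submodule `M ⊂ Ch^{n−1}(M_K(H̃G))_ℂ`** ((6.17) p. 35: «the image under the evaluation map …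
`π_f^K ⊗ Hom_{𝓗_K}(π_f^K, M) → M`»): the `ℂ`-span of the values `φ(v)` of equivariant maps `φ` into `M`.  REAL (Mathlib `Submodule.span`).
[cite: RapoportSmithlingZhang2020Diagonal, §6.4 (6.17) p. 35] -/
def heckeIsotypic (K : Subgroup D.LevelAmb) (π : D.AutRep) (M : Submodule ℂ (ℂ ⊗[ℚ] (D.hs K).Ch (D.W.n - 1))) :
    Submodule ℂ (ℂ ⊗[ℚ] (D.hs K).Ch (D.W.n - 1)) :=
  Submodule.span ℂ {m | ∃ φ : D.piK K π →ₗ[ℂ] ℂ ⊗[ℚ] (D.hs K).Ch (D.W.n - 1),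
    D.IsHeckeEquivariant K π φ ∧ (∀ v, φ v ∈ M) ∧ ∃ v, φ v = m}

/-- **The carrier `bb` IS the pairing (6.2)∕(6.3) of §6.1 on `M_K(H̃G)`** («Now we assume that Conj. 6.1 and 6.2 hold for `M_K(H̃G)`, and that we therefore have the
Beilinson–Bloch height pairing (6.2) between cohomologically trivial cycles for `i = n − 1`», p. 36): for a model `𝒳` of `M_K(H̃G)` with its arithmetic Chow data
(`M`, supplied by the consumer — the ⟨CARRIER⟩ convention of `BBModelData.Eq63_wellDefined`), `bb K c₁ c₂` is a value `(c₁, c₂)_{BB}` of the REAL relation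
`BBModelData.BBRel` (6.3) for all `c₁, c₂ ∈ Ch^{n−1}(M_K(H̃G))_{ℚ,0}` (degrees `i = j = n − 1`: `d + 1 − (n − 1) = n − 1` since `d = 2n − 3`, Remark 6.3).  Predicate on
the datum and the model (ED. 2: replaces ED. 1's structure field `bb_spec`, whose internal `∀ M` was vacuous — T-ref6 QA-R6-2).
[cite: RapoportSmithlingZhang2020Diagonal, §6.4 p. 36, §6.1 (6.2)–(6.3) p. 31] -/
def BBSpec (K : Subgroup D.LevelAmb) (M : BBModelData (D.hs K)) : Prop :=
  ∀ c₁ ∈ (D.hs K).Ch0 (D.W.n - 1), ∀ c₂ ∈ (D.hs K).Ch0 (D.W.n - 1), M.BBRel (D.W.n - 1) (D.W.n - 1) c₁ c₂ (D.bb K c₁ c₂)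

/-- **`ℓ_K`** (p. 36): «Pairing against the distinguished element `z_{K,0} ∈ Ch^{n−1}(M_K(H̃G))_{ℚ,0}` then defines a linear functional
`ℓ_K : Ch^{n−1}(M_K(H̃G))_{ℂ,0} → ℂ`, `z ↦ (z, z_{K,0})_{BB}`» («We extend it to a hermitian form on `Ch^{n−1}(M_K(H̃G))_{ℂ,0}`», linear in the first variable) — the
`ℂ`-linear extension of `z ↦ (z, z_{K,0})_{BB}` (⟨CARRIER⟩ `bb`) to the complexification (Mathlib `LinearMap.baseChange`, `Algebra.TensorProduct.lmul''`; junk off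
`Ch_{ℂ,0}`).  REAL. [cite: RapoportSmithlingZhang2020Diagonal, §6.4 p. 36] -/
def ellK (KH : Subgroup ((FiniteAdeleRing (𝓞 F) F)ˣ × D.Wflat.Gfin)) (K : Subgroup D.LevelAmb) (f : D.HK K) :
    ℂ ⊗[ℚ] (D.hs K).Ch (D.W.n - 1) →ₗ[ℂ] ℂ :=
  (Algebra.TensorProduct.lmul'' ℚ (S := ℂ)).toLinearMap ∘ₗ
    (((Complex.ofRealAm.toLinearMap.restrictScalars ℚ) ∘ₗ ((D.bb K).flip (D.zK0 KH K f))).baseChange ℂ)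

/-- **[RSZ2020, Conj. 6.10]** («The first version of the Arithmetic Gan–Gross–Prasad conj[.] can now be stated as follows», pp. 35–36) — the statement POSED, not
proved, in loc. cit. as item 6.10; typed as a predicate on the datum; nothing in this file claims it: «Let `K ⊂ H̃G(𝔸_f)` be an open compact
subgroup. Let `π` be as above, i.e., with trivial restriction to the central subgroup `Z^ℚ(𝔸)` and lying in a cohomological tempered Arthur packet. Consider the
following conditions on `π`. (a) `dim Hom_{𝓗_K}(π_f^K, Z_{K,0}) = 1`. (b) The order of vanishing `ord_{s=1/2} L(s, π, R)` equals one, the space `Hom_{H̃(𝔸_f)}(π_f, ℂ)` is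
one-dimensional, and its generator does not vanish on the subspace `π_f^K ⊂ π_f`. (c) `Hom_{𝓗_K}(π_f^K, Ch^{n−1}(M_K(H̃G))_{ℂ,0}) ≠ 0`. Then (a) and (b) are equivalent
and imply (c). If `E = F`, then (a), (b) and (c′) are equivalent, where (c′) `dim Hom_{𝓗_K}(π_f^K, Ch^{n−1}(M_K(H̃G))_{ℂ,0}) = 1`» (footnote 15: «we always have
`dim Hom_{𝓗_K}(π_f^K, Z_{K,0}) ≤ 1`, because `Z_{K,0}` is a cyclic `𝓗_K`-module»).  `Z_{K,0}`, `z_{K,0}` for a level `K_{H̃}` of `H̃` and an odd Hecke–Künneth projector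
`f_−` (Def. 6.7), `K_{H̃}` as in `IsDiagonalLevel` (p. 34); «`dim Hom = 1`» = a non-zero equivariant map exists and every equivariant map is a multiple of it.
[cite: RapoportSmithlingZhang2020Diagonal, §6.4 Conj. 6.10 pp. 35–36] -/
def RSZ2020_6_10 : Prop :=
  ∀ (K : Subgroup D.LevelAmb), D.IsLevelHG K →
  ∀ (KH : Subgroup ((FiniteAdeleRing (𝓞 F) F)ˣ × D.Wflat.Gfin)), D.IsDiagonalLevel K KH → ∀ (fm : D.HK K), D.IsHeckeKunnethProjector K 1 fm →
  ∀ π : D.AutRep, D.IsAsIn610 π →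
    let ZK0C : Submodule ℂ (ℂ ⊗[ℚ] (D.hs K).Ch (D.W.n - 1)) :=
      Submodule.span ℂ ((TensorProduct.mk ℚ ℂ ((D.hs K).Ch (D.W.n - 1)) 1) '' (D.ZK0 KH K fm : Set _))
    let Ch0C : Submodule ℂ (ℂ ⊗[ℚ] (D.hs K).Ch (D.W.n - 1)) :=
      Submodule.span ℂ ((TensorProduct.mk ℚ ℂ ((D.hs K).Ch (D.W.n - 1)) 1) '' ((D.hs K).Ch0 (D.W.n - 1) : Set _))
    let dimOne : Submodule ℂ (ℂ ⊗[ℚ] (D.hs K).Ch (D.W.n - 1)) → Prop := fun M =>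
      ∃ φ₀ : D.piK K π →ₗ[ℂ] ℂ ⊗[ℚ] (D.hs K).Ch (D.W.n - 1), D.IsHeckeEquivariant K π φ₀ ∧ (∀ v, φ₀ v ∈ M) ∧ φ₀ ≠ 0 ∧
        ∀ φ : D.piK K π →ₗ[ℂ] ℂ ⊗[ℚ] (D.hs K).Ch (D.W.n - 1), D.IsHeckeEquivariant K π φ → (∀ v, φ v ∈ M) → ∃ c : ℂ, φ = c • φ₀
    let nonzero : Submodule ℂ (ℂ ⊗[ℚ] (D.hs K).Ch (D.W.n - 1)) → Prop := fun M =>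
      ∃ φ : D.piK K π →ₗ[ℂ] ℂ ⊗[ℚ] (D.hs K).Ch (D.W.n - 1), D.IsHeckeEquivariant K π φ ∧ (∀ v, φ v ∈ M) ∧ φ ≠ 0
    let condA : Prop := dimOne ZK0C
    let condB : Prop := D.ordL π = 1 ∧ D.HomHLine K π
    let condC : Prop := nonzero Ch0C
    let condC' : Prop := dimOne Ch0C ∧ D.HomHLine K π
    (condA ↔ condB) ∧ (condA → condC) ∧ (D.EeqF → ((condA ↔ condB) ∧ (condB ↔ condC')))

/-- **[RSZ2020, Conj. 6.12]** («The second version of the Arithmetic Gan–Gross–Prasad conj[.] in terms of the height pairing», p. 36; stated after «Now we assume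
that Conj[.] 6.1 and 6.2 hold for `M_K(H̃G)`») — the statement POSED, not proved, in loc. cit. as item 6.12; typed as a predicate on the datum; nothing in this
file claims it: «Let `K ⊂ H̃G(𝔸_f)` be an open compact subgroup. Let `π` be as above. Then the
following conditions on `π` are equivalent. (a) `ℓ_K|_{Z_{K,0}[π_f^K]} ≠ 0`. (b) The order of vanishing `ord_{s=1/2} L(s, π, R)` equals one, the space
`Hom_{H̃(𝔸_f)}(π_f, ℂ)` is one-dimensional, and its generator does not vanish on the subspace `π_f^K ⊂ π_f`. (c) `ℓ_K|_{Ch^{n−1}(M_K(H̃G))_{ℂ,0}[π_f^K]} ≠ 0`.»  Isotypic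
components by (6.17) (`heckeIsotypic`), `ℓ_K` by `ellK`; typed under the printed standing assumption that Conj. 6.1 and 6.2 hold for `M_K(H̃G)` and that `( , )_{BB}` is
the resulting pairing, in the junk-safe form «there IS a regular proper flat model with arithmetic Chow data satisfying Conj. 6.2 whose pairing (6.3) is `bb K`»
(`∃ M : BBModelData (hs K), M.IsAsInConj61 ∧ M.RSZ2020_6_2_surjective ∧ BBSpec K M`; ED. 2 — ED. 1's internal `∀ M` hypothesis was unsatisfiable on the intended
datum, T-ref6 QA-R6-2). [cite: RapoportSmithlingZhang2020Diagonal, §6.4 Conj. 6.12 p. 36] -/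
def RSZ2020_6_12 : Prop :=
  ∀ (K : Subgroup D.LevelAmb), D.IsLevelHG K →
    (∃ M : BBModelData (D.hs K), M.IsAsInConj61 ∧ M.RSZ2020_6_2_surjective ∧ D.BBSpec K M) →
  ∀ (KH : Subgroup ((FiniteAdeleRing (𝓞 F) F)ˣ × D.Wflat.Gfin)), D.IsDiagonalLevel K KH → ∀ (fm : D.HK K), D.IsHeckeKunnethProjector K 1 fm →
  ∀ π : D.AutRep, D.IsAsIn610 π →
    let ZK0C : Submodule ℂ (ℂ ⊗[ℚ] (D.hs K).Ch (D.W.n - 1)) :=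
      Submodule.span ℂ ((TensorProduct.mk ℚ ℂ ((D.hs K).Ch (D.W.n - 1)) 1) '' (D.ZK0 KH K fm : Set _))
    let Ch0C : Submodule ℂ (ℂ ⊗[ℚ] (D.hs K).Ch (D.W.n - 1)) :=
      Submodule.span ℂ ((TensorProduct.mk ℚ ℂ ((D.hs K).Ch (D.W.n - 1)) 1) '' ((D.hs K).Ch0 (D.W.n - 1) : Set _))
    let condA : Prop := ∃ z ∈ D.heckeIsotypic K π ZK0C, D.ellK KH K fm z ≠ 0
    let condB : Prop := D.ordL π = 1 ∧ D.HomHLine K π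
    let condC : Prop := ∃ z ∈ D.heckeIsotypic K π Ch0C, D.ellK KH K fm z ≠ 0
    (condA ↔ condB) ∧ (condB ↔ condC)

/-! ## Remark 6.17 (p. 37): cases of everywhere good reduction -/

/-- **[RSZ2020, Remark 6.17]** (p. 37), the construction of everywhere good reduction: «let us assume now that `K = K_{H̃G} = K_{Z^ℚ} × K_H × K_G`, where `K_{Z^ℚ}` is the
usual maximal compact subgroup (3.7), `K_G` is the stabilizer of a lattice `Λ` in `W`, and `K_H` is the stabilizer of a lattice `Λ♭` in `W♭`. We make the following
assumptions on the field extensions `F/F₀/ℚ`: • Each finite place `v` of `F₀` which is ramified over `ℚ` or of residue characteristic `2` is split in `F`. • Each finite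
place `v` of `F₀` which ramifies in `F` is of degree one over `ℚ`. … When `n = 2m + 1` is odd, we impose that • `W` is split at all finite places of `F₀` which are inert
in `F`; and • `W♭` is split at all finite places, which forces `m` and `[F₀ : ℚ]` to be odd … When `n = 2m` is even, we impose that • `W` is split at all finite places of
`F₀` … and • `W♭` is split at all finite places of `F₀` which are inert in `F`. … With these definitions, `M_K(H̃G)` has everywhere good reduction.» — typed as: under
the REAL hypotheses on `F/F₀/ℚ`, `W` (Gram matrix ★ `gramW`) and `W♭` (★ `Wflat.gram`) (★ `IsRamifiedOverQ`, ★ `residueChar`, ★ `IsSplit`, ★ `IsRamifiedPlace`, ★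
`IsDegreeOneOverQ`, ★ `hermIsSplitAt`, ★ `IsInert`), THERE IS an open compact level `K` (the printed one: stabilizers of the lattices «`Λ_v` self-dual when `v` is
split or inert, almost `π_v`-modular [n odd] ∕ `π_v`-modular [n even] when `v` is ramified; `Λ♭_v` self-dual when `v` is inert, `π_v`-modular [n odd] ∕ almost
`π_v`-modular [n even] when `v` is ramified» — «Such lattices exist», RECORDED) such that `M_K(H̃G)` admits a model smooth of relative dimension `2n − 3` and proper over
`Spec O_E` (★ `IntegralModel.IsSmoothProper`; «everywhere good reduction»).  Weaker than print (level unspecified — existentially hidden; lattice conditions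
RECORDED), never stronger.  Named fact
(predicate on the datum). [cite: RapoportSmithlingZhang2020Diagonal, §6.4 Remark 6.17 p. 37] -/
def Rem617 : Prop :=
  (∀ v : HeightOneSpectrum (𝓞 F₀), (IsRamifiedOverQ v ∨
      Literature.NumberTheory.Automorphic.Liu2021.AppendixC.SecC4IntegralModelsUniformization.residueChar v = 2) →
    Literature.NumberTheory.Automorphic.Liu2021.AppendixC.SecC4IntegralModelsUniformization.IsSplit F v) →
  (∀ v : HeightOneSpectrum (𝓞 F₀), IsRamifiedPlace F₀ F v → IsDegreeOneOverQ v) →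
  (Odd D.W.n →
    (∀ v : HeightOneSpectrum (𝓞 F₀), Literature.NumberTheory.Automorphic.Liu2021.AppendixC.SecC4IntegralModelsUniformization.IsInert F v →
      hermIsSplitAt F₀ F D.gramW v) ∧
    (∀ v : HeightOneSpectrum (𝓞 F₀), hermIsSplitAt F₀ F D.Wflat.gram v)) →
  (Even D.W.n →
    (∀ v : HeightOneSpectrum (𝓞 F₀), hermIsSplitAt F₀ F D.gramW v) ∧
    (∀ v : HeightOneSpectrum (𝓞 F₀), Literature.NumberTheory.Automorphic.Liu2021.AppendixC.SecC4IntegralModelsUniformization.IsInert F v →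
      hermIsSplitAt F₀ F D.Wflat.gram v)) →
  ∃ K : Subgroup D.LevelAmb, D.IsLevelHG K ∧
    ∃ 𝒳 : IntegralModel (𝓞 (reflexFieldOf D.Φ D.φ₀)) (reflexFieldOf D.Φ D.φ₀) (D.hs K).X, 𝒳.IsSmoothProper (2 * D.W.n - 3)

/-! ## ED. 3 (squad ruling R-9a): the tree-provable closed row (6.13) PROVED -/

omit [NumberField F₀] in
/-- **(6.13) holds** (discharge of `Eq613_range`, squad ruling R-9a: a tree-provable closed row is a theorem): an odd Hecke–Künneth projector `f_−` acts
as `0` on the even-degree cohomology `H^{2(n−1)}(Sh_K(H̃G), ℚ)` (`IsHeckeKunnethProjector K 1 f`), so by the axiom `cl_equivariant` of the carriers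
`cl_{n−1}(R(f_−) x) = f_− · cl_{n−1}(x) = 0`, i.e. `R(f_−) x ∈ Ch^{n−1}(M_K(H̃G))_{ℚ,0} = ker cl_{n−1}` — exactly the printed reason («We obtain a map to the
Chow group of cohomologically trivial cycles», p. 34).  Our proof (by unfolding). [cite: RapoportSmithlingZhang2020Diagonal, §6.3 (6.13) p. 34] -/
theorem Eq613_range_holds : D.Eq613_range := by
  intro K f hf x
  have h2 : (((2 * (D.W.n - 1) : ℕ) : ZMod 2)) = 0 := by
    rw [Nat.cast_mul, show ((2 : ℕ) : ZMod 2) = 0 from by decide, zero_mul]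
  have hH : D.heckeH K (2 * (D.W.n - 1)) f = 0 := by
    rw [hf (2 * (D.W.n - 1)), h2, if_neg (by decide)]
  show D.heckeCh K f x ∈ LinearMap.ker ((D.hs K).cl (D.W.n - 1))
  rw [LinearMap.mem_ker, D.cl_equivariant, hH, LinearMap.zero_apply]

end Sec6Data

end Literature.AlgebraicGeometry.ShimuraVarieties.RapoportSmithlingZhang2020.Sec6ArithmeticIntersectionConjecture
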